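import Literature.MathematicalPhysics.QuantumLattice.SectorGroundState
import Literature.MathematicalPhysics.QuantumLattice.HubbardSpinChargeCertificate
import HarnessLib

/-!
# Eigenstate ("energy-window") rows in bootstrap certificates: soundness (family F11)

HONEST FRAMING (page 1): ladder R1–R4 with certified numbers; no claim on H/H₀. This file is a
SOUNDNESS EDGE for one extra constraint family of the many-body-bootstrap certificates (pub-hubbard
cell, seat `pseudo`, family F11 of `PSEUDO.md` §1 / `TO-ENG.md` §A); no certificate using it exists yet.

Han–Hartnoll–Kruthoff's single-particle bootstrap uses, besides `⟨[H,O]⟩ = 0`, the STRONGER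
eigenstate relation `⟨O H⟩ = E ⟨O⟩` (PRL 125 (2020) 041601, p. 2, "a strengthened version of (2)"),
with `E` SCANNED as a test parameter. For a Hermitian matrix `H` and the vector state `ω = ⟨ψ, · ψ⟩`
of an eigenvector (a sector ground state) the same relation `ω(H X) = E ω(X) = ω(X H)` holds, and it
has a CONVEX consequence that needs no scan, only a certified window `E_lo ≤ E ≤ E_up` (an earlier
certified lower bound; a variational upper bound): for operators `Mᵢ` and a coefficient matrix `W ⪰ 0`
  `ω(Σᵢⱼ Wᵢⱼ (½(H Mᵢ⋆Mⱼ + Mᵢ⋆Mⱼ H) − E_lo Mᵢ⋆Mⱼ)) = (E − E_lo)·ω(Σᵢⱼ Wᵢⱼ Mᵢ⋆Mⱼ) ≥ 0`,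
  `ω(Σᵢⱼ Wᵢⱼ (E_up Mᵢ⋆Mⱼ − ½(H Mᵢ⋆Mⱼ + Mᵢ⋆Mⱼ H))) = (E_up − E)·ω(Σᵢⱼ Wᵢⱼ Mᵢ⋆Mⱼ) ≥ 0`
(`eigWindowLo/Up`, `map_eigWindowLo_eq`, `map_eigWindowLo_nonneg`, …) — in primal form the moment
LMIs `Z − E_lo·M ⪰ 0`, `E_up·M − Z ⪰ 0` (`M = [ω(Mᵢ⋆Mⱼ)]`, `Z = [ω(½{H, Mᵢ⋆Mⱼ})]`), in dual form
two further NONNEGATIVE terms of the certificate identity next to the Gram term: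
  `H − c·1 = Σ Λᵢⱼ Oᵢ⋆Oⱼ + null + (eigWindowLo H E_lo W₁ M₁ + eigWindowUp H E_up W₂ M₂ + r)`,
  `Λ, W₁, W₂ ⪰ 0`, `ω(null) = 0`, `−ε ≤ Re ω(r)`  ⇒  `c − ε ≤ E`   (`le_of_certificate_eigWindow`).
Matrix instances in the shapes of the tree's `certsdp/1` soundness theorems: a unit eigenvector
(`eigenvalue_ge_of_certificate_eigWindow`, cf. `Matrix.eigenvalue_ge_of_certificate`); the tracial
sector ground state with unitary symmetries and scalar charges
(`minEnergyOn_ge_of_symmetric_certificate_eigWindow`, Heisenberg tori); a joint `(K, Q)` ground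
vector with `Q`-charged null words (`minEnergyOn_ge_of_certificate_eigWindow`, Hubbard tori
`(N, S^z)`); the Hubbard `N`-particle sector (`groundEnergyAt_ge_of_certificate_eigWindow`). The window
hypotheses are ordinary hypotheses (an earlier certificate gives `E_lo`, a trial state `E_up`); with
`W₁ = W₂ = 0` everything reduces to the existing residual certificates. All PROVED; no named fact.

References: Han–Hartnoll–Kruthoff, PRL 125 (2020) 041601 = arXiv:2004.10212, p. 2
[cite: HanHartnollKruthoff2020, p. 2]; Han, arXiv:2006.06002 §2 [cite: Han2020Bootstrap, §2];
Kull–Schuch–Dive–Navascués, PRX 14 (2024) 021008 §5.3 (residual duals) [cite: KullEtAl2024, §5.3].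
-/

noncomputable section

open Matrix Finset Literature.MathematicalPhysics.QuantumManyBody.StateRelaxation
open Literature.MathematicalPhysics.QuantumLattice hiding vectorState vectorState_apply
open scoped ComplexOrder MatrixOrder BigOperators

namespace Summit.HubbardSuperconductivity.HubbardLadder

/-! ### Abstract `⋆`-algebra: the two window elements and their values in an eigenstate -/

section Abstract

variable {𝓐 : Type*} [Ring 𝓐] [StarRing 𝓐] [Algebra ℂ 𝓐] [StarModule ℂ 𝓐]
variable {m : Type*} [Fintype m]

/-- The LOWER eigen-window element `Σᵢⱼ Wᵢⱼ • (½ (h Mᵢ⋆Mⱼ + Mᵢ⋆Mⱼ h) − E • Mᵢ⋆Mⱼ)` of a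
Hamiltonian `h`, a reference energy `E`, a coefficient matrix `W` and a family `M` (dual of the
moment-block inequality `Z − E·M ⪰ 0`, HHK's `⟨OH⟩ = E⟨O⟩` relaxed to a certified `E_lo ≤ E`).
[cite: HanHartnollKruthoff2020, p. 2] -/
def eigWindowLo (h : 𝓐) (E : ℝ) (W : Matrix m m ℂ) (M : m → 𝓐) : 𝓐 :=
  ∑ i, ∑ j, W i j • ((2 : ℂ)⁻¹ • (h * (star (M i) * M j) + star (M i) * M j * h) -
    (E : ℂ) • (star (M i) * M j))

/-- The UPPER eigen-window element `Σᵢⱼ Wᵢⱼ • (E • Mᵢ⋆Mⱼ − ½ (h Mᵢ⋆Mⱼ + Mᵢ⋆Mⱼ h))` (dual of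
`E·M − Z ⪰ 0` for a certified `E ≥` the eigenvalue, e.g. a variational energy).
[cite: HanHartnollKruthoff2020, p. 2] -/
def eigWindowUp (h : 𝓐) (E : ℝ) (W : Matrix m m ℂ) (M : m → 𝓐) : 𝓐 :=
  ∑ i, ∑ j, W i j • ((E : ℂ) • (star (M i) * M j) -
    (2 : ℂ)⁻¹ • (h * (star (M i) * M j) + star (M i) * M j * h))

omit [StarModule ℂ 𝓐] in
/-- With the zero coefficient matrix the lower window element vanishes (the theorems below then
reduce to the plain residual certificates). [folklore] -/
@[simp] theorem eigWindowLo_zero (h : 𝓐) (E : ℝ) (M : m → 𝓐) :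
    eigWindowLo h E (0 : Matrix m m ℂ) M = 0 := by
  simp [eigWindowLo]

omit [StarRing 𝓐] [StarModule ℂ 𝓐] [Fintype m] in
/-- In a functional with the two-sided eigen property `ω(h x) = E ω(x) = ω(x h)` the symmetrised
product `½ (h x + x h)` has value `E ω(x)` — HHK's `⟨OH⟩ = E⟨O⟩`. [cite: HanHartnollKruthoff2020, p. 2] -/
theorem map_half_anticomm_of_eigen (ω : 𝓐 →ₗ[ℂ] ℂ) {h : 𝓐} {E : ℝ}
    (hL : ∀ x, ω (h * x) = (E : ℂ) * ω x) (hR : ∀ x, ω (x * h) = (E : ℂ) * ω x) (x : 𝓐) :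
    ω ((2 : ℂ)⁻¹ • (h * x + x * h)) = (E : ℂ) * ω x := by
  rw [map_smul, map_add, hL, hR, smul_eq_mul]
  ring

omit [StarModule ℂ 𝓐] in
/-- **Value of the lower window element in an eigenstate**: `(E − E_lo) · ω(gramForm W M)`.
[cite: HanHartnollKruthoff2020, p. 2] -/
theorem map_eigWindowLo_eq (ω : 𝓐 →ₗ[ℂ] ℂ) {h : 𝓐} {E : ℝ}
    (hL : ∀ x, ω (h * x) = (E : ℂ) * ω x) (hR : ∀ x, ω (x * h) = (E : ℂ) * ω x)
    (E_lo : ℝ) (W : Matrix m m ℂ) (M : m → 𝓐) :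
    ω (eigWindowLo h E_lo W M) = ((E - E_lo : ℝ) : ℂ) * ω (gramForm W M) := by
  unfold eigWindowLo
  simp only [map_sum]
  rw [map_gramForm, Finset.mul_sum]
  refine Finset.sum_congr rfl fun i _ => ?_
  rw [Finset.mul_sum]
  refine Finset.sum_congr rfl fun j _ => ?_
  rw [map_smul, map_sub, map_half_anticomm_of_eigen ω hL hR, map_smul, smul_eq_mul, smul_eq_mul,
    Complex.ofReal_sub]
  ring

omit [StarModule ℂ 𝓐] in
/-- **Value of the upper window element in an eigenstate**: `(E_up − E) · ω(gramForm W M)`.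
[cite: HanHartnollKruthoff2020, p. 2] -/
theorem map_eigWindowUp_eq (ω : 𝓐 →ₗ[ℂ] ℂ) {h : 𝓐} {E : ℝ}
    (hL : ∀ x, ω (h * x) = (E : ℂ) * ω x) (hR : ∀ x, ω (x * h) = (E : ℂ) * ω x)
    (E_up : ℝ) (W : Matrix m m ℂ) (M : m → 𝓐) :
    ω (eigWindowUp h E_up W M) = ((E_up - E : ℝ) : ℂ) * ω (gramForm W M) := by
  unfold eigWindowUp
  simp only [map_sum]
  rw [map_gramForm, Finset.mul_sum]
  refine Finset.sum_congr rfl fun i _ => ?_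
  rw [Finset.mul_sum]
  refine Finset.sum_congr rfl fun j _ => ?_
  rw [map_smul, map_sub, map_half_anticomm_of_eigen ω hL hR, map_smul, smul_eq_mul, smul_eq_mul,
    Complex.ofReal_sub]
  ring

/-- **The lower window element is nonnegative in a positive eigen-functional** when `W ⪰ 0` and
`E_lo ≤ E` (primal reading: `Z − E_lo·M = (E − E_lo)·M ⪰ 0`). [cite: HanHartnollKruthoff2020, p. 2] -/
theorem map_eigWindowLo_nonneg [DecidableEq m] (ω : 𝓐 →ₗ[ℂ] ℂ)
    (hpos : ∀ a, 0 ≤ ω (star a * a)) {h : 𝓐} {E : ℝ}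
    (hL : ∀ x, ω (h * x) = (E : ℂ) * ω x) (hR : ∀ x, ω (x * h) = (E : ℂ) * ω x)
    {E_lo : ℝ} (hlo : E_lo ≤ E) {W : Matrix m m ℂ} (hW : W.PosSemidef) (M : m → 𝓐) :
    0 ≤ ω (eigWindowLo h E_lo W M) := by
  rw [map_eigWindowLo_eq ω hL hR]
  exact mul_nonneg (Complex.zero_le_real.mpr (sub_nonneg.mpr hlo)) (map_gramForm_nonneg ω hpos hW M)

/-- **The upper window element is nonnegative in a positive eigen-functional** when `W ⪰ 0` and
`E ≤ E_up` (primal reading: `E_up·M − Z = (E_up − E)·M ⪰ 0`). [cite: HanHartnollKruthoff2020, p. 2] -/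
theorem map_eigWindowUp_nonneg [DecidableEq m] (ω : 𝓐 →ₗ[ℂ] ℂ)
    (hpos : ∀ a, 0 ≤ ω (star a * a)) {h : 𝓐} {E : ℝ}
    (hL : ∀ x, ω (h * x) = (E : ℂ) * ω x) (hR : ∀ x, ω (x * h) = (E : ℂ) * ω x)
    {E_up : ℝ} (hup : E ≤ E_up) {W : Matrix m m ℂ} (hW : W.PosSemidef) (M : m → 𝓐) :
    0 ≤ ω (eigWindowUp h E_up W M) := by
  rw [map_eigWindowUp_eq ω hL hR]
  exact mul_nonneg (Complex.zero_le_real.mpr (sub_nonneg.mpr hup)) (map_gramForm_nonneg ω hpos hW M)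

/-- **Weak duality with eigen-window terms.** A positive normalised functional with the two-sided
eigen property for `h` at energy `E`, a certified window `E_lo ≤ E ≤ E_up`, and an identity
`h − c·1 = gramForm Λ O + n + (eigWindowLo h E_lo W₁ M₁ + eigWindowUp h E_up W₂ M₂ + r)` with
`Λ, W₁, W₂ ⪰ 0`, `ω(n) = 0`, `−ε ≤ Re ω(r)` give `c − ε ≤ E`. (HHK's eigenstate rows in dual form;
KSDN §5.3 for the residual.) [cite: HanHartnollKruthoff2020, p. 2] -/
theorem le_of_certificate_eigWindow [DecidableEq m] (ω : 𝓐 →ₗ[ℂ] ℂ)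
    (hpos : ∀ a, 0 ≤ ω (star a * a)) (hone : ω 1 = 1) {h : 𝓐} {E : ℝ}
    (hL : ∀ x, ω (h * x) = (E : ℂ) * ω x) (hR : ∀ x, ω (x * h) = (E : ℂ) * ω x)
    {Λ : Matrix m m ℂ} (hΛ : Λ.PosSemidef) (O : m → 𝓐) {n r : 𝓐} (hn : ω n = 0)
    {m₁ : Type*} [Fintype m₁] [DecidableEq m₁] {W₁ : Matrix m₁ m₁ ℂ} (hW₁ : W₁.PosSemidef)
    (M₁ : m₁ → 𝓐) {E_lo : ℝ} (hlo : E_lo ≤ E)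
    {m₂ : Type*} [Fintype m₂] [DecidableEq m₂] {W₂ : Matrix m₂ m₂ ℂ} (hW₂ : W₂.PosSemidef)
    (M₂ : m₂ → 𝓐) {E_up : ℝ} (hup : E ≤ E_up)
    {ε : ℝ} (hr : -ε ≤ (ω r).re) {c : ℝ}
    (hcert : h - (c : ℂ) • (1 : 𝓐) =
      gramForm Λ O + n + (eigWindowLo h E_lo W₁ M₁ + eigWindowUp h E_up W₂ M₂ + r)) :
    c - ε ≤ E := by
  have h1 : 0 ≤ (ω (eigWindowLo h E_lo W₁ M₁)).re :=
    (Complex.nonneg_iff.mp (map_eigWindowLo_nonneg ω hpos hL hR hlo hW₁ M₁)).1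
  have h2 : 0 ≤ (ω (eigWindowUp h E_up W₂ M₂)).re :=
    (Complex.nonneg_iff.mp (map_eigWindowUp_nonneg ω hpos hL hR hup hW₂ M₂)).1
  have hr' : -ε ≤ (ω (eigWindowLo h E_lo W₁ M₁ + eigWindowUp h E_up W₂ M₂ + r)).re := by
    rw [map_add, map_add, Complex.add_re, Complex.add_re]
    linarith
  have hmain := le_re_map_of_certificate_residual ω hpos hone hΛ O hn hr' hcert
  have hωh : ω h = (E : ℂ) := by
    have := hL 1
    rwa [mul_one, hone, mul_one] at this
  rwa [hωh, Complex.ofReal_re] at hmain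

end Abstract

/-! ### Matrix instances: a unit eigenvector -/

section MatrixInstances

variable {n : Type*} [Fintype n] [DecidableEq n] {m : Type*} [Fintype m] [DecidableEq m]

omit [DecidableEq n] in
/-- `⟨v, A X v⟩ = E ⟨v, X v⟩` for an eigenvector `A v = E v` of a Hermitian `A`.
[cite: HanHartnollKruthoff2020, p. 2] -/
theorem vectorState_mul_left_of_eigenvector {A : Matrix n n ℂ} (hA : A.IsHermitian) {E : ℝ}
    {v : n → ℂ} (hAv : A *ᵥ v = (E : ℂ) • v) (X : Matrix n n ℂ) :
    vectorState v (A * X) = (E : ℂ) * vectorState v X := by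
  rw [vectorState_apply, vectorState_apply, ← mulVec_mulVec, dotProduct_mulVec,
    star_vecMul_of_eigenvector hA hAv, smul_dotProduct, smul_eq_mul]

omit [DecidableEq n] in
/-- `⟨v, X A v⟩ = E ⟨v, X v⟩` for an eigenvector `A v = E v`. [cite: HanHartnollKruthoff2020, p. 2] -/
theorem vectorState_mul_right_of_eigenvector {A : Matrix n n ℂ} {E : ℝ}
    {v : n → ℂ} (hAv : A *ᵥ v = (E : ℂ) • v) (X : Matrix n n ℂ) :
    vectorState v (X * A) = (E : ℂ) * vectorState v X := by
  rw [vectorState_apply, vectorState_apply, ← mulVec_mulVec, hAv, mulVec_smul, dotProduct_smul,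
    smul_eq_mul]

/-- **Certificate with eigen-window terms ⇒ eigenvalue lower bound.** For a Hermitian `A`, a unit
eigenvector `A v = E v`, a window `E_lo ≤ E ≤ E_up` and an identity
`A − c·1 = gramForm Λ O + (Σₖ (A Xₖ − Xₖ A) + Σₗ (Yₗ Zₗ + Z'ₗ Y'ₗ) + Σⱼ Nⱼ)
  + (eigWindowLo A E_lo W₁ M₁ + eigWindowUp A E_up W₂ M₂ + r)`
with `Λ, W₁, W₂ ⪰ 0`, `Zₗ v = 0`, `Z'ₗᴴ v = 0`, `⟨v, Nⱼ v⟩ = 0` and `−ε ≤ Re ⟨v, r v⟩`: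
`c − ε ≤ E`. [cite: HanHartnollKruthoff2020, p. 2] -/
theorem eigenvalue_ge_of_certificate_eigWindow {A : Matrix n n ℂ} (hA : A.IsHermitian)
    {E : ℝ} {v : n → ℂ} (hv : star v ⬝ᵥ v = 1) (hAv : A *ᵥ v = (E : ℂ) • v)
    {Λ : Matrix m m ℂ} (hΛ : Λ.PosSemidef) (O : m → Matrix n n ℂ)
    {κ : Type*} (s : Finset κ) (X : κ → Matrix n n ℂ)
    {ι : Type*} (t : Finset ι) (Y Z Z' Y' : ι → Matrix n n ℂ)
    (hZ : ∀ l ∈ t, Z l *ᵥ v = 0) (hZ' : ∀ l ∈ t, (Z' l)ᴴ *ᵥ v = 0)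
    {ι' : Type*} (u : Finset ι') (Nn : ι' → Matrix n n ℂ)
    (hNn : ∀ j ∈ u, star v ⬝ᵥ Nn j *ᵥ v = 0)
    {m₁ : Type*} [Fintype m₁] [DecidableEq m₁] {W₁ : Matrix m₁ m₁ ℂ} (hW₁ : W₁.PosSemidef)
    (M₁ : m₁ → Matrix n n ℂ) {E_lo : ℝ} (hlo : E_lo ≤ E)
    {m₂ : Type*} [Fintype m₂] [DecidableEq m₂] {W₂ : Matrix m₂ m₂ ℂ} (hW₂ : W₂.PosSemidef)
    (M₂ : m₂ → Matrix n n ℂ) {E_up : ℝ} (hup : E ≤ E_up)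
    {r : Matrix n n ℂ} {ε : ℝ} (hr : -ε ≤ (star v ⬝ᵥ r *ᵥ v).re) {c : ℝ}
    (hcert : A - (c : ℂ) • (1 : Matrix n n ℂ) =
      gramForm Λ O + (∑ k ∈ s, (A * X k - X k * A) + ∑ l ∈ t, (Y l * Z l + Z' l * Y' l) +
        ∑ j ∈ u, Nn j) + (eigWindowLo A E_lo W₁ M₁ + eigWindowUp A E_up W₂ M₂ + r)) :
    c - ε ≤ E := by
  set ω := vectorState v with hω
  have hpos : ∀ a : Matrix n n ℂ, 0 ≤ ω (star a * a) := fun a => vectorState_nonneg v a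
  have hone : ω 1 = 1 := by rw [hω, vectorState_apply, one_mulVec, hv]
  have hL : ∀ x, ω (A * x) = (E : ℂ) * ω x := fun x => vectorState_mul_left_of_eigenvector hA hAv x
  have hR : ∀ x, ω (x * A) = (E : ℂ) * ω x := fun x => vectorState_mul_right_of_eigenvector hAv x
  have hnull : ω (∑ k ∈ s, (A * X k - X k * A) + ∑ l ∈ t, (Y l * Z l + Z' l * Y' l) +
      ∑ j ∈ u, Nn j) = 0 := by
    rw [map_add, map_add, map_sum, map_sum, map_sum]
    have h1 : ∀ k ∈ s, ω (A * X k - X k * A) = 0 := fun k _ => vectorState_commutator hA hAv _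
    have h2 : ∀ l ∈ t, ω (Y l * Z l + Z' l * Y' l) = 0 := fun l hl => by
      rw [map_add, hω, vectorState_mul_of_mulVec_eq_zero v _ (hZ l hl),
        vectorState_mul_of_conjTranspose_mulVec_eq_zero v _ (hZ' l hl), add_zero]
    have h3 : ∀ j ∈ u, ω (Nn j) = 0 := fun j hj => by rw [hω, vectorState_apply]; exact hNn j hj
    rw [Finset.sum_eq_zero h1, Finset.sum_eq_zero h2, Finset.sum_eq_zero h3, add_zero, add_zero]
  have hr' : -ε ≤ (ω r).re := by rw [hω, vectorState_apply]; exact hr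
  exact le_of_certificate_eigWindow ω hpos hone hL hR hΛ O hnull hW₁ M₁ hlo hW₂ M₂ hup hr' hcert

end MatrixInstances

/-! ### Matrix instances: sector ground states (tracial, and joint with a second charge) -/

section SectorInstances

variable {n : Type*} [Fintype n] [DecidableEq n]

/-- **Symmetric sector certificate with eigen-window terms.** As
`minEnergyOn_ge_of_symmetric_certificate` (tracial ground state of the sector `K`: positivity,
commutators, unitary symmetries `Uₗ`, scalar charges `Qᵣ = qᵣ` on `K`), plus the two window terms for
a certified window `E_lo ≤ minEnergyOn A K ≤ E_up` and a residual with `−ε ≤ Re ω_P(r)` in the tracial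
sector ground state `P = sectorGroundProj A K`: `c − ε ≤ minEnergyOn A K`. (The Heisenberg-torus
instance of the `certsdp/1` `sector`/symmetrised mode with an `eig` block.)
[cite: HanHartnollKruthoff2020, p. 2] -/
theorem minEnergyOn_ge_of_symmetric_certificate_eigWindow {A : Matrix n n ℂ} (hA : A.IsHermitian)
    (K : Submodule ℂ (n → ℂ)) (hKA : ∀ v ∈ K, A *ᵥ v ∈ K) (hK : K ≠ ⊥)
    {m : Type*} [Fintype m] [DecidableEq m] {Λ : Matrix m m ℂ} (hΛ : Λ.PosSemidef)
    (O : m → Matrix n n ℂ)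
    {κ : Type*} (s : Finset κ) (X : κ → Matrix n n ℂ)
    {ι : Type*} (t : Finset ι) (U Y : ι → Matrix n n ℂ) (hU : ∀ l ∈ t, U l * A = A * U l)
    (hUK : ∀ l ∈ t, ∀ v ∈ K, U l *ᵥ v ∈ K) (hUK' : ∀ l ∈ t, ∀ v ∈ K, (U l)ᴴ *ᵥ v ∈ K)
    (hUU : ∀ l ∈ t, (U l)ᴴ * U l = 1)
    {ρ : Type*} (r : Finset ρ) (Q Z Z' : ρ → Matrix n n ℂ) (q : ρ → ℝ)
    (hQh : ∀ i ∈ r, (Q i).IsHermitian) (hQ : ∀ i ∈ r, ∀ v ∈ K, Q i *ᵥ v = ((q i : ℝ) : ℂ) • v)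
    {m₁ : Type*} [Fintype m₁] [DecidableEq m₁] {W₁ : Matrix m₁ m₁ ℂ} (hW₁ : W₁.PosSemidef)
    (M₁ : m₁ → Matrix n n ℂ) {E_lo : ℝ} (hlo : E_lo ≤ A.minEnergyOn K)
    {m₂ : Type*} [Fintype m₂] [DecidableEq m₂] {W₂ : Matrix m₂ m₂ ℂ} (hW₂ : W₂.PosSemidef)
    (M₂ : m₂ → Matrix n n ℂ) {E_up : ℝ} (hup : A.minEnergyOn K ≤ E_up)
    {res : Matrix n n ℂ} {ε : ℝ} (hres : -ε ≤ ((A.sectorGroundProj K).projState res).re)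
    {c : ℝ}
    (hcert : A - (c : ℂ) • (1 : Matrix n n ℂ) =
      gramForm Λ O + (∑ k ∈ s, (A * X k - X k * A) + ∑ l ∈ t, (U l * Y l * (U l)ᴴ - Y l) +
        ∑ i ∈ r, (Z i * (Q i - ((q i : ℝ) : ℂ) • 1) + (Q i - ((q i : ℝ) : ℂ) • 1) * Z' i)) +
        (eigWindowLo A E_lo W₁ M₁ + eigWindowUp A E_up W₂ M₂ + res)) :
    c - ε ≤ A.minEnergyOn K := by
  set P := A.sectorGroundProj K with hP
  set e : ℂ := ((A.minEnergyOn K : ℝ) : ℂ) with he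
  have hPh : P.IsHermitian := sectorGroundProj_isHermitian A K
  have hP2 : P * P = P := sectorGroundProj_mul_self A K
  have hP0 : P ≠ 0 := sectorGroundProj_ne_zero hA K hKA hK
  have hAP : A * P = e • P := mul_sectorGroundProj A K
  have hPA : P * A = e • P := sectorGroundProj_mul hA K
  set ω := P.projState with hω
  have hpos : ∀ a : Matrix n n ℂ, 0 ≤ ω (star a * a) := fun a => by
    rw [hω, star_eq_conjTranspose]; exact projState_nonneg hPh hP2 a
  have hone : ω 1 = 1 := projState_one hPh hP2 hP0
  have hL : ∀ x, ω (A * x) = e * ω x := fun x => projState_mul_left hPA x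
  have hR : ∀ x, ω (x * A) = e * ω x := fun x => projState_mul_right hAP x
  have hnull : ω (∑ k ∈ s, (A * X k - X k * A) + ∑ l ∈ t, (U l * Y l * (U l)ᴴ - Y l) +
      ∑ i ∈ r, (Z i * (Q i - ((q i : ℝ) : ℂ) • 1) + (Q i - ((q i : ℝ) : ℂ) • 1) * Z' i)) = 0 := by
    rw [map_add, map_add, map_sum, map_sum, map_sum]
    have h1 : ∀ k ∈ s, ω (A * X k - X k * A) = 0 := fun k _ => projState_commutator hAP hPA _
    have h2 : ∀ l ∈ t, ω (U l * Y l * (U l)ᴴ - Y l) = 0 := fun l hl => by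
      rw [map_sub, hω, projState_conj (sectorGroundProj_commute hA K (hU l hl) (hUK l hl) (hUK' l hl))
        (hUU l hl), sub_self]
    have h3 : ∀ i ∈ r, ω (Z i * (Q i - ((q i : ℝ) : ℂ) • 1) + (Q i - ((q i : ℝ) : ℂ) • 1) * Z' i) = 0 :=
      fun i hi => by
        rw [map_add, hω, projState_mul_of_mul_eq_zero (sub_smul_mul_sectorGroundProj A K (hQ i hi)),
          projState_mul_of_mul_eq_zero' (sectorGroundProj_mul_sub_smul A K (hQh i hi) (hQ i hi)),
          add_zero]
    rw [Finset.sum_eq_zero h1, Finset.sum_eq_zero h2, Finset.sum_eq_zero h3, add_zero, add_zero]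
  have hres' : -ε ≤ (ω res).re := hres
  exact le_of_certificate_eigWindow ω hpos hone hL hR hΛ O hnull hW₁ M₁ hlo hW₂ M₂ hup hres' hcert

/-- **Charged sector certificate with eigen-window terms.** As `minEnergyOn_ge_of_certificate_charged`
(a joint `(K, Q)` ground vector: positivity, commutators, sector annihilators `Zₗ v = 0 = Z'ₗᴴ v`,
`Q`-charged null operators, residual `−ε ≤ Re ⟨v, r v⟩` on unit vectors of `K`), plus the two window
terms for a certified window `E_lo ≤ minEnergyOn A K ≤ E_up`: `c − ε ≤ minEnergyOn A K`. (The
Hubbard-torus `(N, S^z)` instance of a `certsdp/1` certificate with an `eig` block.)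
[cite: HanHartnollKruthoff2020, p. 2] -/
theorem minEnergyOn_ge_of_certificate_eigWindow {A Q : Matrix n n ℂ} (hA : A.IsHermitian)
    (K : Submodule ℂ (n → ℂ)) (hKA : ∀ v ∈ K, A *ᵥ v ∈ K) (hK : K ≠ ⊥) (hQ : Q.IsHermitian)
    (hQA : Q * A = A * Q) (hQK : ∀ v ∈ K, Q *ᵥ v ∈ K)
    {m : Type*} [Fintype m] [DecidableEq m] {Λ : Matrix m m ℂ} (hΛ : Λ.PosSemidef)
    (O : m → Matrix n n ℂ)
    {κ : Type*} (s : Finset κ) (X : κ → Matrix n n ℂ)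
    {ι : Type*} (t : Finset ι) (Y Z Z' Y' : ι → Matrix n n ℂ)
    (hZ : ∀ l ∈ t, ∀ v ∈ K, Z l *ᵥ v = 0) (hZ' : ∀ l ∈ t, ∀ v ∈ K, (Z' l)ᴴ *ᵥ v = 0)
    {ρ : Type*} (u : Finset ρ) (Nc : ρ → Matrix n n ℂ) (k : ρ → ℂ) (hk : ∀ j ∈ u, k j ≠ 0)
    (hNc : ∀ j ∈ u, Q * Nc j - Nc j * Q = k j • Nc j)
    {m₁ : Type*} [Fintype m₁] [DecidableEq m₁] {W₁ : Matrix m₁ m₁ ℂ} (hW₁ : W₁.PosSemidef)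
    (M₁ : m₁ → Matrix n n ℂ) {E_lo : ℝ} (hlo : E_lo ≤ A.minEnergyOn K)
    {m₂ : Type*} [Fintype m₂] [DecidableEq m₂] {W₂ : Matrix m₂ m₂ ℂ} (hW₂ : W₂.PosSemidef)
    (M₂ : m₂ → Matrix n n ℂ) {E_up : ℝ} (hup : A.minEnergyOn K ≤ E_up)
    {r : Matrix n n ℂ} {ε : ℝ}
    (hr : ∀ v ∈ K, star v ⬝ᵥ v = 1 → -ε ≤ (star v ⬝ᵥ r *ᵥ v).re) {c : ℝ}
    (hcert : A - (c : ℂ) • (1 : Matrix n n ℂ) =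
      gramForm Λ O + (∑ k ∈ s, (A * X k - X k * A) + ∑ l ∈ t, (Y l * Z l + Z' l * Y' l) +
        ∑ j ∈ u, Nc j) + (eigWindowLo A E_lo W₁ M₁ + eigWindowUp A E_up W₂ M₂ + r)) :
    c - ε ≤ A.minEnergyOn K := by
  obtain ⟨v, hvK, hv1, hAv, q, hQv⟩ :=
    exists_unit_joint_eigenvector_minEnergyOn hA K hKA hK hQ hQA hQK
  exact eigenvalue_ge_of_certificate_eigWindow hA hv1 hAv hΛ O s X t Y Z Z' Y'
    (fun l hl => hZ l hl v hvK) (fun l hl => hZ' l hl v hvK) u Nc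
    (fun j hj => star_dotProduct_mulVec_eq_zero_of_charge hQ hQv (hk j hj) (hNc j hj))
    hW₁ M₁ hlo hW₂ M₂ hup (hr v hvK hv1) hcert

end SectorInstances

/-! ### The Hubbard `N`-particle sector -/

section Hubbard

variable {Λ : Type*} [LinearOrder Λ] [Fintype Λ]
variable (G : SimpleGraph Λ) [DecidableRel G.Adj]

/-- **Charged Hubbard certificate with eigen-window terms ⇒ sector ground-energy lower bound.**
As `groundEnergyAt_ge_of_certificate_charged` (identity with Gram term, commutators, `N̂ − N` ideal
terms, charged ladder words, residual ladder words `Σ aₖ vₖ`), plus `eigWindowLo H E_lo W₁ M₁ +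
eigWindowUp H E_up W₂ M₂` with `W₁, W₂ ⪰ 0` and a certified window
`E_lo ≤ groundEnergyAt G t U N ≤ E_up` (an earlier certificate for the same `(G, t, U, N)`; a trial
state): `c − Σₖ ‖aₖ‖ ≤ groundEnergyAt G t U N` (`N ≤ 2|Λ|`). Soundness of a `certsdp/1` sector-mode
certificate extended by an `eig` block. [cite: HanHartnollKruthoff2020, p. 2] -/
theorem groundEnergyAt_ge_of_certificate_eigWindow (t U : ℝ) {N : ℕ} (hN : N ≤ 2 * Fintype.card Λ)
    {m : Type*} [Fintype m] [DecidableEq m] {Λm : Matrix m m ℂ} (hΛ : Λm.PosSemidef)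
    (O : m → Matrix (Finset (Orb Λ)) (Finset (Orb Λ)) ℂ)
    {κ : Type*} (s : Finset κ) (X : κ → Matrix (Finset (Orb Λ)) (Finset (Orb Λ)) ℂ)
    {κ' : Type*} (s' : Finset κ') (Y Y' : κ' → Matrix (Finset (Orb Λ)) (Finset (Orb Λ)) ℂ)
    {ρ : Type*} (u : Finset ρ) (b : ρ → ℂ) (cw : ρ → List (Orb Λ × Bool))
    (hcw : ∀ j ∈ u, ladderCharge (cw j) ≠ 0 ∨ ladderSpinCharge (cw j) ≠ 0)
    {m₁ : Type*} [Fintype m₁] [DecidableEq m₁] {W₁ : Matrix m₁ m₁ ℂ} (hW₁ : W₁.PosSemidef)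
    (M₁ : m₁ → Matrix (Finset (Orb Λ)) (Finset (Orb Λ)) ℂ) {E_lo : ℝ}
    (hlo : E_lo ≤ groundEnergyAt G t U N)
    {m₂ : Type*} [Fintype m₂] [DecidableEq m₂] {W₂ : Matrix m₂ m₂ ℂ} (hW₂ : W₂.PosSemidef)
    (M₂ : m₂ → Matrix (Finset (Orb Λ)) (Finset (Orb Λ)) ℂ) {E_up : ℝ}
    (hup : groundEnergyAt G t U N ≤ E_up)
    {κ'' : Type*} (w : Finset κ'') (a : κ'' → ℂ) (word : κ'' → List (Orb Λ × Bool)) {c : ℝ}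
    (hcert : hamiltonian G t U - (c : ℂ) • (1 : Matrix (Finset (Orb Λ)) (Finset (Orb Λ)) ℂ) =
      gramForm Λm O +
        ((∑ k ∈ s, (hamiltonian G t U * X k - X k * hamiltonian G t U) +
          ∑ l ∈ s', (Y l * (totalNumberOp - (N : ℂ) • 1) + (totalNumberOp - (N : ℂ) • 1) * Y' l)) +
          ∑ j ∈ u, b j • ladderWord (cw j)) +
        (eigWindowLo (hamiltonian G t U) E_lo W₁ M₁ + eigWindowUp (hamiltonian G t U) E_up W₂ M₂ +
          ∑ k ∈ w, a k • ladderWord (word k))) :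
    c - ∑ k ∈ w, ‖a k‖ ≤ groundEnergyAt G t U N := by
  obtain ⟨ψ, hψN, hψ1, hHψ, q, hSψ⟩ := exists_unit_joint_groundState G t U hN
  have hHh := LiebThm1.hamiltonian_isHermitian G t U
  have hZ : (totalNumberOp - (N : ℂ) • (1 : Matrix (Finset (Orb Λ)) (Finset (Orb Λ)) ℂ)) *ᵥ ψ = 0 :=
    totalNumberOp_sub_mulVec_of_isNParticle N hψN
  have hZ' : (totalNumberOp - (N : ℂ) • (1 : Matrix (Finset (Orb Λ)) (Finset (Orb Λ)) ℂ))ᴴ *ᵥ ψ = 0 := by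
    rw [conjTranspose_totalNumberOp_sub]; exact hZ
  have hNn : ∀ j ∈ u, star ψ ⬝ᵥ (b j • ladderWord (cw j)) *ᵥ ψ = 0 := fun j hj => by
    rw [Matrix.smul_mulVec, dotProduct_smul, smul_eq_mul]
    rcases hcw j hj with hq | hq
    · rw [star_dotProduct_ladderWord_mulVec_eq_zero hψN (cw j) hq, mul_zero]
    · rw [star_dotProduct_ladderWord_mulVec_eq_zero_of_spinCharge hSψ (cw j) hq, mul_zero]
  have hr : -(∑ k ∈ w, ‖a k‖) ≤
      (star ψ ⬝ᵥ (∑ k ∈ w, a k • ladderWord (word k)) *ᵥ ψ).re := by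
    have h := neg_sum_norm_le_re_map_sum w (vectorState ψ) a (fun k => ladderWord (word k))
      fun k _ => by
        have h := (isContraction_prod_ladder (word k)).neg_norm_mul_le (a k) ψ
        rw [hψ1, Complex.one_re, mul_one] at h
        rw [vectorState_apply, ladderWord_eq_prod]
        exact h
    rwa [vectorState_apply] at h
  exact eigenvalue_ge_of_certificate_eigWindow hHh hψ1 hHψ hΛ O s X s'
    Y (fun _ => totalNumberOp - (N : ℂ) • 1) (fun _ => totalNumberOp - (N : ℂ) • 1) Y'
    (fun _ _ => hZ) (fun _ _ => hZ') u (fun j => b j • ladderWord (cw j)) hNn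
    hW₁ M₁ hlo hW₂ M₂ hup hr hcert

end Hubbard

end Summit.HubbardSuperconductivity.HubbardLadder
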